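import Mathlib
import Literature.NumberTheory.Irrationality.Zlobin2005.SorokinIntegralCoefficients
import HarnessLib

/-!
# Uniqueness of the expansion in generalized polylogarithms — PROOF of `Zlobin2005.expansion_unique`

Proofs-only sibling of `Zlobin2005/SorokinIntegralCoefficients.lean` (pattern
`Zlobin2005/LeIntegralRepresentationProofs.lean`): it DISCHARGES the named Literature fact
`Literature.NumberTheory.Irrationality.Zlobin2005.expansion_unique` by the theorem `expansion_unique_holds`
at the end of the file; NO new definition, NO new named fact, the statement file is untouched.

What is proved. [cite: Zlobin2005Coefficients, §1 (sentence after eq. (1))]: "This representation is unique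
because of the linear independence of `Le_{s⃗}(z)` with different indices over `ℂ(z)` (see [zl5])",
[zl5] = [Zlobin2005Expansion] (S. A. Zlobin, *Expansion of multiple integrals in linear forms*, Mat. Zametki
77 (2005) 683–706 = Math. Notes 77 (2005) 630–652). In the tree's rendering (`expansion_unique`): a finitely
supported family `coef : List ℕ →₀ ℚ[X]` indexed by words of positive integers with
`Σ_{s⃗} coef_{s⃗}(z⁻¹)·Le_{s⃗}(z) = 0` for all real `0 < z < 1` is zero. On the way the file proves the
function-field statement behind it, `ExpansionUnique.Le_linearIndependent_polynomial`: **the functions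
`Le_{s⃗}` (`s⃗` a word of positive integers, `Le_∅ = 1`) are linearly independent over `ℝ[z]` on `(0,1)`.**

The printed source [zl5] is not held (paywalled; acquisition request acq-13458); the proof formalised here is
the classical differentiation descent for (multiple) polylogarithms, made explicit:

* `Le` in the coordinates `k ∈ ℕ^l` (`n_j = 1 + Σ_{t ≥ j} k_t`, the reindexing bijection of
  `LeIntegralRepresentationProofs.lean`, re-proved privately here): `Le_{s⃗}(z) = Σ_k z^{|k|+1} ∏_j n_j^{-s_j}`,
  and for `s⃗ = a :: s⃗'` the product form over `ℕ × ℕ^{l-1}` (`Le_cons_eq_tsum_prod`);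
* termwise differentiation on `(−r, r)` (`hasDerivAt_tsum_of_isPreconnected`; the majorant
  `Σ_k (|k|+1) r^{|k|} ≤ ∏_t Σ_n (n+1) rⁿ`), giving the classical rules for `0 < z < 1`:
  `z·Le'_{a::s⃗'} = Le_{(a−1)::s⃗'}` (`a ≥ 2`), `z(1−z)·Le'_{1::s⃗'} = Le_{s⃗'}` (`s⃗' ≠ ∅`),
  `(1−z)·Le'_{(1)} = 1` (`hasDerivAt_Le_cons_of_two_le`, `hasDerivAt_Le_one_cons`, `hasDerivAt_Le_one`);
* two lemmas on real polynomials: a vanishing Wronskian `P Q' = P' Q`, `P ≠ 0`, forces `Q = c·P`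
  (`eq_smul_of_wronskian_eq_zero`), and the residue lemma `X(1−X)(P Q' − P' Q) = (A(1−X) + BX)·P²`, `P ≠ 0`
  `⇒ A = B = 0` — "`(Q/P)'` has no residues at `0` and `1`", proved by comparing `X`-adic orders and by the
  reflection `X ↦ 1 − X` (`residue_zero`);
* the descent (`descent`): induction on the weight `M` and on the number of nonzero coefficients of weight
  `M`. Given a relation `Σ_v P_v Le_v = 0` with a top word `w₀`, `P_{w₀} ≠ 0`, the combination
  `z(1−z)·(P_{w₀}·(Σ_v P_v Le_v)' − P_{w₀}'·Σ_v P_v Le_v) = 0`, regrouped by the rules above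
  (`descent_relation`; each word `s⃗` collects its two "parents" `(s₁+1, s₂, …)` and `(1, s₁, …)`), is a
  relation with fewer nonzero top coefficients, hence trivial; its top coefficients give `P_s ∝ P_{w₀}`
  for all top `s⃗`, and its coefficient at `∂w₀` then reads `(P_{∂w₀}/P_{w₀})' = α/z + β/(1−z)` with
  `(α, β) ≠ (0, 0)` — contradicting the residue lemma;
* `expansion_unique_holds`: clear the negative powers (`z^D·p(z⁻¹)` is `eval z (reflect D p)`,
  `Polynomial.eval₂_reflect_mul_pow`) and apply the linear independence to the reflected real polynomials.

Only real `0 < z < 1` is used, as in the typed statement (the printed `ℂ(z)`-version on the disc is not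
needed by any user). All auxiliary statements are private and written out in the tree's vocabulary
(`leIndexSet`, `leadIndex`, `Le`, `mzvTerm`); tail sums are spelled `∑ t ∈ univ.filter (fun t => j ≤ t), k t`
and the set of positive words of weight `≤ M` is spelled through `Composition` (no auxiliary definition).
HONEST FRAMING (cell zeta5-irr / pub-zeta5): an identity-of-functions statement; nothing here concerns the
arithmetic nature of any constant. References: [Zlobin2005Coefficients] (arXiv:math/0511245, §1, held text
`paper:arxiv-math_0511245` p. 2, re-read on the page), [Zlobin2005Expansion] (as reported there).
-/

noncomputable section

open MeasureTheory Set Finset Polynomial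
open scoped Topology

namespace Literature.NumberTheory.Irrationality.Zlobin2005

open Literature.NumberTheory.Transcendental (mzvTerm)

namespace ExpansionUnique

/-! ### Tail sums and the reindexing `ℕ^l ≃ {n₁ ≥ ⋯ ≥ n_l ≥ 1}` (as in `LeIntegralRepresentationProofs`) -/

/-- Splitting off the first term of a tail sum: `Σ_{t ≥ j} k_t = k_j + Σ_{t ≥ j+1} k_t`. [folklore] -/
private theorem tailSum_succ {l : ℕ} (k : Fin l → ℕ) (j : Fin l) :
    ∑ t ∈ univ.filter (fun t : Fin l => (j : ℕ) ≤ (t : ℕ)), k t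
      = k j + ∑ t ∈ univ.filter (fun t : Fin l => (j : ℕ) + 1 ≤ (t : ℕ)), k t := by
  have hset : univ.filter (fun t : Fin l => (j : ℕ) ≤ (t : ℕ))
      = insert j (univ.filter (fun t : Fin l => (j : ℕ) + 1 ≤ (t : ℕ))) := by
    ext t
    simp only [Finset.mem_filter, Finset.mem_univ, true_and, Finset.mem_insert]
    constructor
    · intro h
      by_cases hjt : t = j
      · exact Or.inl hjt
      · right
        have : (t : ℕ) ≠ (j : ℕ) := fun h' => hjt (Fin.ext h')
        omega
    · rintro (rfl | h)
      · exact le_rfl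
      · omega
  have hnot : j ∉ univ.filter (fun t : Fin l => (j : ℕ) + 1 ≤ (t : ℕ)) := by simp
  rw [hset, Finset.sum_insert hnot]

/-- A tail sum over an empty range vanishes: `Σ_{t ≥ j} k_t = 0` for `j ≥ l`. [folklore] -/
private theorem tailSum_eq_zero {l : ℕ} (k : Fin l → ℕ) {j : ℕ} (hj : l ≤ j) :
    ∑ t ∈ univ.filter (fun t : Fin l => j ≤ (t : ℕ)), k t = 0 := by
  have : univ.filter (fun t : Fin l => j ≤ (t : ℕ)) = ∅ := by
    ext t
    simp only [Finset.mem_filter, Finset.mem_univ, true_and, Finset.notMem_empty, iff_false, not_le]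
    exact lt_of_lt_of_le t.2 hj
  rw [this, Finset.sum_empty]

/-- The full tail sum is the total: `Σ_{t ≥ 0} k_t = Σ_t k_t`. [folklore] -/
private theorem tailSum_zero {l : ℕ} (k : Fin l → ℕ) :
    ∑ t ∈ univ.filter (fun t : Fin l => 0 ≤ (t : ℕ)), k t = ∑ t, k t := by
  have : (Finset.univ : Finset (Fin l)).filter (fun t : Fin l => 0 ≤ (t : ℕ)) = Finset.univ := by
    ext t; simp
  rw [this]

/-- The chain `n_j = 1 + Σ_{t ≥ j} k_t` of `k ∈ ℕ^l` lies in `leIndexSet l`. [folklore] -/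
private theorem chain_mem_leIndexSet {l : ℕ} (k : Fin l → ℕ) :
    (fun j : Fin l => ∑ t ∈ univ.filter (fun t : Fin l => (j : ℕ) ≤ (t : ℕ)), k t + 1) ∈ leIndexSet l := by
  refine ⟨?_, fun i => Nat.succ_pos _⟩
  intro i j hij
  apply Nat.add_le_add_right
  apply Finset.sum_le_sum_of_subset
  intro t
  simp only [Finset.mem_filter, Finset.mem_univ, true_and]
  intro h
  exact le_trans (Fin.le_iff_val_le_val.mp hij) h

/-- Successive differences of the chain of `k` give back `k`. [folklore] -/
private theorem diff_chain {l : ℕ} (k : Fin l → ℕ) (j : Fin l) :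
    (∑ t ∈ univ.filter (fun t : Fin l => (j : ℕ) ≤ (t : ℕ)), k t + 1)
      - (if h : (j : ℕ) + 1 < l then
          (∑ t ∈ univ.filter (fun t : Fin l => ((⟨(j : ℕ) + 1, h⟩ : Fin l) : ℕ) ≤ (t : ℕ)), k t + 1)
        else 1)
      = k j := by
  rw [tailSum_succ k j]
  split_ifs with h
  · dsimp only
    omega
  · rw [tailSum_eq_zero k (show l ≤ (j : ℕ) + 1 by omega)]
    omega

/-- The chain of the successive differences of a chain is the chain itself. [folklore] -/
private theorem chain_diff {l : ℕ} {n : Fin l → ℕ} (hn : n ∈ leIndexSet l) (j : Fin l) :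
    ∑ t ∈ univ.filter (fun t : Fin l => (j : ℕ) ≤ (t : ℕ)),
        (n t - (if h : (t : ℕ) + 1 < l then n ⟨(t : ℕ) + 1, h⟩ else 1)) + 1 = n j := by
  obtain ⟨hanti, hpos⟩ := hn
  obtain ⟨l', rfl⟩ : ∃ l', l = l' + 1 := ⟨l - 1, by have := j.2; omega⟩
  induction j using Fin.reverseInduction with
  | last =>
      rw [tailSum_succ, tailSum_eq_zero _ (by simp), dif_neg (by simp)]
      have h1 := hpos (Fin.last l')
      simp only [add_zero]
      omega
  | cast i ih =>
      rw [tailSum_succ]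
      rw [show ((Fin.succ i : Fin (l' + 1)) : ℕ) = (i : ℕ) + 1 from rfl] at ih
      rw [show ((Fin.castSucc i : Fin (l' + 1)) : ℕ) = (i : ℕ) from rfl,
        dif_pos (by simp [i.2] : (i : ℕ) + 1 < l' + 1)]
      have heq : (⟨(i : ℕ) + 1, by simp [i.2]⟩ : Fin (l' + 1)) = Fin.succ i := Fin.ext rfl
      rw [heq]
      have hle : n (Fin.succ i) ≤ n (Fin.castSucc i) := hanti (Fin.castSucc_lt_succ (i := i)).le
      have h1 := hpos (Fin.succ i)
      omega

/-- **The reindexing bijection** `ℕ^l ≃ {n₁ ≥ n₂ ≥ ⋯ ≥ n_l ≥ 1}`, `k ↦ n`, `n_j = 1 + Σ_{t ≥ j} k_t`. [folklore] -/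
private theorem exists_equiv_leIndexSet (l : ℕ) :
    ∃ e : (Fin l → ℕ) ≃ leIndexSet l, ∀ k : Fin l → ℕ,
      ((e k : leIndexSet l) : Fin l → ℕ)
        = fun j : Fin l => ∑ t ∈ univ.filter (fun t : Fin l => (j : ℕ) ≤ (t : ℕ)), k t + 1 :=
  ⟨{ toFun := fun k => ⟨_, chain_mem_leIndexSet k⟩
     invFun := fun n j => n.1 j - (if h : (j : ℕ) + 1 < l then n.1 ⟨(j : ℕ) + 1, h⟩ else 1)
     left_inv := fun k => funext fun j => diff_chain k j
     right_inv := fun n => Subtype.ext (funext fun j => chain_diff n.2 j) },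
    fun _ => rfl⟩

/-- `Le` in the coordinates `k ∈ ℕ^l` (nonempty index): `Le_s(z) = Σ_{k ∈ ℕ^l} z^{|k|+1} ∏_j n_j^{-s_j}`,
`n_j = 1 + Σ_{t ≥ j} k_t`, `|k| = Σ_t k_t` — an unconditional reindexing. [folklore] -/
private theorem Le_eq_tsum_pi (s : List ℕ) (hs : s ≠ []) (z : ℝ) :
    Le s z = ∑' k : Fin s.length → ℕ, z ^ (∑ t, k t + 1) *
      mzvTerm s (fun j => ∑ t ∈ univ.filter (fun t : Fin s.length => (j : ℕ) ≤ (t : ℕ)), k t + 1) := by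
  obtain ⟨e, he⟩ := exists_equiv_leIndexSet s.length
  have hl : 0 < s.length := List.length_pos_of_ne_nil hs
  unfold Le
  rw [← e.tsum_eq]
  refine tsum_congr fun k => ?_
  rw [he k]
  congr 2
  simp only [leadIndex, dif_pos hl]
  rw [tailSum_zero]

/-! ### The `cons` structure of the chains -/

/-- Head of the chain of `cons k₀ k'`: `n₁ = k₀ + |k'| + 1`. [folklore] -/
private theorem chain_cons_zero {l : ℕ} (k₀ : ℕ) (k' : Fin l → ℕ) :
    ∑ t ∈ univ.filter (fun t : Fin (l + 1) => 0 ≤ (t : ℕ)),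
        (Fin.cons k₀ k' : Fin (l + 1) → ℕ) t + 1 = k₀ + ∑ t, k' t + 1 := by
  rw [tailSum_zero, Fin.sum_cons]

/-- Tail of the chain of `cons k₀ k'`: `n_{j+1}(cons k₀ k') = n_j(k')`. [folklore] -/
private theorem chain_cons_succ {l : ℕ} (k₀ : ℕ) (k' : Fin l → ℕ) (j : Fin l) :
    ∑ t ∈ univ.filter (fun t : Fin (l + 1) => (j : ℕ) + 1 ≤ (t : ℕ)),
        (Fin.cons k₀ k' : Fin (l + 1) → ℕ) t + 1
      = ∑ t ∈ univ.filter (fun t : Fin l => (j : ℕ) ≤ (t : ℕ)), k' t + 1 := by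
  congr 1
  simp only [Finset.sum_filter]
  rw [Fin.sum_univ_succ]
  simp only [Fin.cons_zero, Fin.cons_succ, Fin.val_zero, Fin.val_succ, Nat.succ_le_succ_iff]
  simp

/-- The product `∏_i n_i^{-e_i}` over the chain of `cons k₀ k'` splits off its head factor. [folklore] -/
private theorem prod_chain_cons {l : ℕ} (e : Fin (l + 1) → ℕ) (k₀ : ℕ) (k' : Fin l → ℕ) :
    ∏ i : Fin (l + 1), (((∑ t ∈ univ.filter (fun t : Fin (l + 1) => (i : ℕ) ≤ (t : ℕ)),
        (Fin.cons k₀ k' : Fin (l + 1) → ℕ) t + 1 : ℕ) : ℝ) ^ e i)⁻¹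
      = (((k₀ + ∑ t, k' t + 1 : ℕ) : ℝ) ^ e 0)⁻¹ *
        ∏ i : Fin l, (((∑ t ∈ univ.filter (fun t : Fin l => (i : ℕ) ≤ (t : ℕ)), k' t + 1 : ℕ) : ℝ) ^
          e i.succ)⁻¹ := by
  rw [Fin.prod_univ_succ]
  congr 1
  · simp only [Fin.val_zero]
    rw [chain_cons_zero]
  · refine Finset.prod_congr rfl fun j _ => ?_
    simp only [Fin.val_succ]
    rw [chain_cons_succ]

/-- `mzvTerm` of the chain of `cons k₀ k'` for the index `a :: s'`: the head factor `n₁^{-a}` splits off.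
[folklore] -/
private theorem mzvTerm_cons (a : ℕ) (s' : List ℕ) (k₀ : ℕ) (k' : Fin s'.length → ℕ) :
    mzvTerm (a :: s') (fun j => ∑ t ∈ univ.filter (fun t : Fin (a :: s').length => (j : ℕ) ≤ (t : ℕ)),
        (Fin.cons k₀ k' : Fin (s'.length + 1) → ℕ) t + 1)
      = (((k₀ + ∑ t, k' t + 1 : ℕ) : ℝ) ^ a)⁻¹ *
        mzvTerm s' (fun j => ∑ t ∈ univ.filter (fun t : Fin s'.length => (j : ℕ) ≤ (t : ℕ)), k' t + 1) := by
  have h := prod_chain_cons (l := s'.length) (fun i => (a :: s')[i]) k₀ k'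
  simp only [Fin.getElem_fin, Fin.val_zero, Fin.val_succ, List.getElem_cons_zero,
    List.getElem_cons_succ] at h
  unfold mzvTerm
  simp only [Fin.getElem_fin]
  exact h

/-! ### Bounds on the terms -/

/-- `0 ≤ ∏_j n_j^{-s_j}`. [folklore] -/
private theorem mzvTerm_nonneg (s : List ℕ) (n : Fin s.length → ℕ) : 0 ≤ mzvTerm s n := by
  unfold mzvTerm
  exact Finset.prod_nonneg fun i _ => inv_nonneg.mpr (pow_nonneg (Nat.cast_nonneg _) _)

/-- `∏_j n_j^{-s_j} ≤ 1` when all `n_j ≥ 1`. [folklore] -/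
private theorem mzvTerm_le_one (s : List ℕ) (n : Fin s.length → ℕ) (hn : ∀ i, 1 ≤ n i) :
    mzvTerm s n ≤ 1 := by
  unfold mzvTerm
  refine Finset.prod_le_one (fun i _ => inv_nonneg.mpr (pow_nonneg (Nat.cast_nonneg _) _)) ?_
  intro i _
  have h1 : (1 : ℝ) ≤ (n i : ℝ) ^ s[i] := one_le_pow₀ (by exact_mod_cast hn i)
  exact inv_le_one_of_one_le₀ h1

/-- `|k| + 1 ≤ ∏_t (k_t + 1)`. [folklore] -/
private theorem sum_succ_le_prod_succ : ∀ (l : ℕ) (k : Fin l → ℕ), ∑ t, k t + 1 ≤ ∏ t, (k t + 1) := by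
  intro l
  induction l with
  | zero => intro k; simp
  | succ l ih =>
    intro k
    rw [Fin.sum_univ_succ, Fin.prod_univ_succ]
    have h := ih (fun t => k t.succ)
    have h1 : 1 ≤ ∏ t : Fin l, (k t.succ + 1) := Finset.one_le_prod' fun t _ => Nat.le_add_left 1 _
    nlinarith

/-- **Finite products of absolutely summable real series** (over `ℕ`, indexed by `Fin d`): the family
`ν ↦ ∏_t f_t(ν_t)` is absolutely summable and its sum is the product of the sums. [folklore] -/
private theorem summable_norm_piProd_and_tsum : ∀ (d : ℕ) (f : Fin d → ℕ → ℝ),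
    (∀ t, Summable fun n => ‖f t n‖) →
      (Summable fun ν : Fin d → ℕ => ‖∏ t, f t (ν t)‖) ∧
        ∑' ν : Fin d → ℕ, ∏ t, f t (ν t) = ∏ t, ∑' n, f t n := by
  intro d
  induction d with
  | zero =>
    intro f _
    refine ⟨?_, ?_⟩
    · exact (hasSum_fintype _).summable
    · simp [tsum_fintype]
  | succ d ih =>
    intro f hf
    obtain ⟨ih1, ih2⟩ := ih (fun t => f t.succ) (fun t => hf t.succ)
    have h0 := hf 0
    let e : (ℕ × (Fin d → ℕ)) ≃ (Fin (d + 1) → ℕ) := Fin.consEquiv (fun _ => ℕ)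
    have hfun : ∀ p : ℕ × (Fin d → ℕ), ∏ t, f t (e p t) = f 0 p.1 * ∏ t : Fin d, f t.succ (p.2 t) := by
      intro p
      rw [Fin.prod_univ_succ]
      rfl
    have hnorm : Summable fun p : ℕ × (Fin d → ℕ) => ‖f 0 p.1 * ∏ t : Fin d, f t.succ (p.2 t)‖ :=
      Summable.mul_norm (f := f 0) (g := fun ν : Fin d → ℕ => ∏ t : Fin d, f t.succ (ν t)) h0 ih1
    refine ⟨?_, ?_⟩
    · have : Summable fun p : ℕ × (Fin d → ℕ) => ‖∏ t, f t (e p t)‖ := hnorm.congr fun p => by rw [hfun]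
      exact (e.summable_iff (f := fun ν : Fin (d + 1) → ℕ => ‖∏ t, f t (ν t)‖)).mp this
    · rw [Fin.prod_univ_succ, ← ih2, tsum_mul_tsum_of_summable_norm (f := f 0)
        (g := fun ν : Fin d → ℕ => ∏ t : Fin d, f t.succ (ν t)) h0 ih1]
      rw [← e.tsum_eq (fun ν : Fin (d + 1) → ℕ => ∏ t, f t (ν t))]
      exact tsum_congr fun p => hfun p

/-- `Σ_{k ∈ ℕ^l} (|k|+1) r^{|k|} < ∞` for `0 ≤ r < 1`. [folklore] -/
private theorem summable_degSucc_mul_pow (l : ℕ) {r : ℝ} (hr0 : 0 ≤ r) (hr1 : r < 1) :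
    Summable fun k : Fin l → ℕ => ((∑ t, k t : ℕ) + 1 : ℝ) * r ^ (∑ t, k t) := by
  have hgeo : ∀ t : Fin l, Summable fun n : ℕ => ‖((n : ℝ) + 1) * r ^ n‖ := by
    intro t
    have h1 : Summable fun n : ℕ => ((n : ℝ) ^ 1 * r ^ n : ℝ) :=
      summable_pow_mul_geometric_of_norm_lt_one 1 (by rwa [Real.norm_of_nonneg hr0])
    have h2 : Summable fun n : ℕ => (r ^ n : ℝ) := summable_geometric_of_lt_one hr0 hr1
    have h3 : Summable fun n : ℕ => ((n : ℝ) + 1) * r ^ n := by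
      have := h1.add h2
      refine this.congr fun n => ?_
      ring
    refine h3.congr fun n => ?_
    rw [Real.norm_of_nonneg (mul_nonneg (by positivity) (pow_nonneg hr0 _))]
  obtain ⟨hs, -⟩ := summable_norm_piProd_and_tsum l (fun _ n => ((n : ℝ) + 1) * r ^ n) hgeo
  refine Summable.of_nonneg_of_le (fun k => mul_nonneg (by positivity) (pow_nonneg hr0 _)) ?_ hs
  intro k
  rw [Real.norm_of_nonneg (Finset.prod_nonneg fun t _ => mul_nonneg (by positivity) (pow_nonneg hr0 _)),
    Finset.prod_mul_distrib, Finset.prod_pow_eq_pow_sum]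
  refine mul_le_mul_of_nonneg_right ?_ (pow_nonneg hr0 _)
  have h := sum_succ_le_prod_succ l k
  calc ((∑ t, k t : ℕ) + 1 : ℝ) = ((∑ t, k t + 1 : ℕ) : ℝ) := by push_cast; ring
    _ ≤ ((∏ t, (k t + 1) : ℕ) : ℝ) := by exact_mod_cast h
    _ = ∏ t, ((k t : ℝ) + 1) := by push_cast; rfl

/-- **Termwise differentiation** of `y ↦ Σ_i c_i y^{d_i+1}` (`0 ≤ c_i ≤ 1`) at `|z| < r` when
`Σ_i (d_i+1) r^{d_i} < ∞`. [folklore] -/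
private theorem hasDerivAt_tsum_pow {ι : Type*} (c : ι → ℝ) (d : ι → ℕ) (hc0 : ∀ i, 0 ≤ c i)
    (hc1 : ∀ i, c i ≤ 1) {r : ℝ} (hr0 : 0 ≤ r) (hsum : Summable fun i => ((d i : ℝ) + 1) * r ^ d i)
    {z : ℝ} (hz : |z| < r) :
    HasDerivAt (fun y => ∑' i, y ^ (d i + 1) * c i) (∑' i, ((d i : ℝ) + 1) * z ^ d i * c i) z := by
  have ht : IsOpen (Set.Ioo (-r) r) := isOpen_Ioo
  have ht' : IsPreconnected (Set.Ioo (-r) r) := isPreconnected_Ioo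
  have hz' : z ∈ Set.Ioo (-r) r := by
    constructor <;> cases abs_lt.mp hz <;> linarith
  have h0 : (0 : ℝ) ∈ Set.Ioo (-r) r := by
    have : 0 < r := lt_of_le_of_lt (abs_nonneg z) hz
    exact ⟨by linarith, this⟩
  refine hasDerivAt_tsum_of_isPreconnected (g := fun i y => y ^ (d i + 1) * c i)
    (g' := fun i y => ((d i : ℝ) + 1) * y ^ d i * c i) hsum ht ht' ?_ ?_ h0 ?_ hz'
  · intro i y _
    have h := (hasDerivAt_pow (d i + 1) y).mul_const (c i)
    refine h.congr_deriv ?_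
    push_cast
    simp
  · intro i y hy
    have hy' : |y| ≤ r := by
      rw [abs_le]; constructor <;> cases hy <;> linarith
    rw [Real.norm_eq_abs, abs_mul, abs_mul, abs_of_nonneg (hc0 i), abs_of_nonneg (by positivity),
      abs_pow]
    calc ((d i : ℝ) + 1) * |y| ^ d i * c i ≤ ((d i : ℝ) + 1) * r ^ d i * 1 := by
          gcongr
          · exact hc0 i
          · exact hc1 i
      _ = ((d i : ℝ) + 1) * r ^ d i := mul_one _
  · simp only [ne_eq, Nat.add_eq_zero_iff, one_ne_zero, and_false, not_false_eq_true, zero_pow, zero_mul]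
    exact summable_zero

/-! ### The derivative of `Le` -/

/-- The `k`-series of the derivative of `Le_{a :: s'}`. [folklore] -/
private theorem hasDerivAt_Le_cons (a : ℕ) (s' : List ℕ) {z : ℝ} (hz : 0 < z) (hz1 : z < 1) :
    HasDerivAt (fun y => Le (a :: s') y)
      (∑' k : Fin (a :: s').length → ℕ, ((∑ t, k t : ℕ) + 1 : ℝ) * z ^ (∑ t, k t) *
        mzvTerm (a :: s') (fun j => ∑ t ∈ univ.filter (fun t : Fin (a :: s').length => (j : ℕ) ≤ (t : ℕ)),
          k t + 1)) z := by
  have hfun : (fun y => Le (a :: s') y) = fun y => ∑' k : Fin (a :: s').length → ℕ, y ^ (∑ t, k t + 1) *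
      mzvTerm (a :: s') (fun j => ∑ t ∈ univ.filter (fun t : Fin (a :: s').length => (j : ℕ) ≤ (t : ℕ)),
        k t + 1) := funext fun y => Le_eq_tsum_pi (a :: s') (List.cons_ne_nil a s') y
  rw [hfun]
  have hr0 : (0 : ℝ) ≤ (z + 1) / 2 := by linarith
  have hr1 : (z + 1) / 2 < 1 := by linarith
  have hzr : |z| < (z + 1) / 2 := by rw [abs_of_pos hz]; linarith
  have h := hasDerivAt_tsum_pow
    (fun k : Fin (a :: s').length → ℕ => mzvTerm (a :: s')
      (fun j => ∑ t ∈ univ.filter (fun t : Fin (a :: s').length => (j : ℕ) ≤ (t : ℕ)), k t + 1))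
    (fun k => ∑ t, k t) (fun k => mzvTerm_nonneg _ _) (fun k => mzvTerm_le_one _ _ fun i => Nat.le_add_left 1 _)
    hr0 ?_ hzr
  · refine h.congr_deriv ?_
    refine tsum_congr fun k => ?_
    push_cast
    ring
  · have := summable_degSucc_mul_pow (a :: s').length hr0 hr1
    refine this.congr fun k => ?_
    push_cast
    ring

/-- **Product form** of `Le_{a :: s'}`: `Le_{a::s'}(z) = Σ_{(k₀,k') ∈ ℕ × ℕ^{l'}} z^{N} N^{-a} ∏_{j} n_j(k')^{-s'_j}`,
`N = k₀ + |k'| + 1`. [folklore] -/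
private theorem Le_cons_eq_tsum_prod (a : ℕ) (s' : List ℕ) (z : ℝ) :
    Le (a :: s') z = ∑' p : ℕ × (Fin s'.length → ℕ), z ^ (p.1 + ∑ t, p.2 t + 1) *
      ((((p.1 + ∑ t, p.2 t + 1 : ℕ) : ℝ) ^ a)⁻¹ *
        mzvTerm s' (fun j => ∑ t ∈ univ.filter (fun t : Fin s'.length => (j : ℕ) ≤ (t : ℕ)), p.2 t + 1)) := by
  rw [Le_eq_tsum_pi (a :: s') (List.cons_ne_nil a s') z]
  let e : (ℕ × (Fin s'.length → ℕ)) ≃ (Fin (s'.length + 1) → ℕ) := Fin.consEquiv (fun _ => ℕ)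
  refine ((e.tsum_eq _).symm).trans (tsum_congr fun p => ?_)
  show z ^ (∑ t, (Fin.cons p.1 p.2 : Fin (s'.length + 1) → ℕ) t + 1) *
      mzvTerm (a :: s') (fun j => ∑ t ∈ univ.filter (fun t : Fin (a :: s').length => (j : ℕ) ≤ (t : ℕ)),
        (Fin.cons p.1 p.2 : Fin (s'.length + 1) → ℕ) t + 1) = _
  rw [mzvTerm_cons, Fin.sum_cons]

/-- Product form of the derivative series of `Le_{a :: s'}` at `0 < z < 1`. [folklore] -/
private theorem hasDerivAt_Le_cons_prod (a : ℕ) (s' : List ℕ) {z : ℝ} (hz : 0 < z) (hz1 : z < 1) :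
    HasDerivAt (fun y => Le (a :: s') y)
      (∑' p : ℕ × (Fin s'.length → ℕ), (((p.1 + ∑ t, p.2 t : ℕ) : ℝ) + 1) * z ^ (p.1 + ∑ t, p.2 t) *
        ((((p.1 + ∑ t, p.2 t + 1 : ℕ) : ℝ) ^ a)⁻¹ *
          mzvTerm s' (fun j => ∑ t ∈ univ.filter (fun t : Fin s'.length => (j : ℕ) ≤ (t : ℕ)), p.2 t + 1)))
      z := by
  refine (hasDerivAt_Le_cons a s' hz hz1).congr_deriv ?_
  let e : (ℕ × (Fin s'.length → ℕ)) ≃ (Fin (s'.length + 1) → ℕ) := Fin.consEquiv (fun _ => ℕ)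
  refine ((e.tsum_eq _).symm).trans (tsum_congr fun p => ?_)
  show (((∑ t, (Fin.cons p.1 p.2 : Fin (s'.length + 1) → ℕ) t : ℕ) : ℝ) + 1) *
      z ^ (∑ t, (Fin.cons p.1 p.2 : Fin (s'.length + 1) → ℕ) t) *
      mzvTerm (a :: s') (fun j => ∑ t ∈ univ.filter (fun t : Fin (a :: s').length => (j : ℕ) ≤ (t : ℕ)),
        (Fin.cons p.1 p.2 : Fin (s'.length + 1) → ℕ) t + 1) = _
  rw [mzvTerm_cons, Fin.sum_cons]

/-- **`z · Le'_{a::s'}(z) = Le_{(a−1)::s'}(z)` for `a ≥ 2`** (`0 < z < 1`). [folklore] -/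
private theorem hasDerivAt_Le_cons_of_two_le (b : ℕ) (s' : List ℕ) {z : ℝ} (hz : 0 < z) (hz1 : z < 1) :
    HasDerivAt (fun y => Le ((b + 2) :: s') y) (Le ((b + 1) :: s') z / z) z := by
  refine (hasDerivAt_Le_cons_prod (b + 2) s' hz hz1).congr_deriv ?_
  rw [Le_cons_eq_tsum_prod (b + 1) s' z, eq_div_iff hz.ne', ← tsum_mul_right]
  refine tsum_congr fun p => ?_
  have hN : (((p.1 + ∑ t, p.2 t + 1 : ℕ) : ℝ)) ≠ 0 := by positivity
  have hc : (((p.1 + ∑ t, p.2 t : ℕ) : ℝ) + 1) = ((p.1 + ∑ t, p.2 t + 1 : ℕ) : ℝ) := by push_cast; ring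
  rw [hc, pow_succ z (p.1 + ∑ t, p.2 t)]
  field_simp
  ring

/-- The `k'`-series `G_{s'}(z) = Σ_{k'} z^{|k'|} ∏_j n_j(k')^{-s'_j}` is absolutely summable for `0 ≤ z < 1`.
[folklore] -/
private theorem summable_norm_G (s' : List ℕ) {z : ℝ} (hz : 0 ≤ z) (hz1 : z < 1) :
    Summable fun k' : Fin s'.length → ℕ => ‖z ^ (∑ t, k' t) *
      mzvTerm s' (fun j => ∑ t ∈ univ.filter (fun t : Fin s'.length => (j : ℕ) ≤ (t : ℕ)), k' t + 1)‖ := by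
  refine Summable.of_nonneg_of_le (fun _ => norm_nonneg _) ?_ (summable_degSucc_mul_pow s'.length hz hz1)
  intro k'
  rw [Real.norm_of_nonneg (mul_nonneg (pow_nonneg hz _) (mzvTerm_nonneg _ _))]
  have h1 : mzvTerm s' (fun j => ∑ t ∈ univ.filter (fun t : Fin s'.length => (j : ℕ) ≤ (t : ℕ)), k' t + 1)
      ≤ 1 := mzvTerm_le_one _ _ fun i => Nat.le_add_left 1 _
  have h2 : (0 : ℝ) ≤ z ^ (∑ t, k' t) := pow_nonneg hz _
  have h3 : (1 : ℝ) ≤ ((∑ t, k' t : ℕ) : ℝ) + 1 := by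
    have : (0 : ℝ) ≤ ((∑ t, k' t : ℕ) : ℝ) := by positivity
    linarith
  nlinarith [mzvTerm_nonneg s' (fun j => ∑ t ∈ univ.filter (fun t : Fin s'.length => (j : ℕ) ≤ (t : ℕ)),
    k' t + 1)]

/-- For `a = 1` the derivative series factors: `Le'_{1::s'}(z) = (1 − z)⁻¹ · G_{s'}(z)`. [folklore] -/
private theorem hasDerivAt_Le_one_cons_G (s' : List ℕ) {z : ℝ} (hz : 0 < z) (hz1 : z < 1) :
    HasDerivAt (fun y => Le (1 :: s') y)
      ((1 - z)⁻¹ * ∑' k' : Fin s'.length → ℕ, z ^ (∑ t, k' t) *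
        mzvTerm s' (fun j => ∑ t ∈ univ.filter (fun t : Fin s'.length => (j : ℕ) ≤ (t : ℕ)), k' t + 1)) z := by
  refine (hasDerivAt_Le_cons_prod 1 s' hz hz1).congr_deriv ?_
  have hgeo : Summable fun n : ℕ => ‖z ^ n‖ := by
    simp_rw [norm_pow, Real.norm_of_nonneg hz.le]
    exact summable_geometric_of_lt_one hz.le hz1
  rw [← tsum_geometric_of_lt_one hz.le hz1, tsum_mul_tsum_of_summable_norm hgeo (summable_norm_G s' hz.le hz1)]
  refine tsum_congr fun p => ?_
  have hN : (((p.1 + ∑ t, p.2 t + 1 : ℕ) : ℝ)) ≠ 0 := by positivity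
  have hc : (((p.1 + ∑ t, p.2 t : ℕ) : ℝ) + 1) = ((p.1 + ∑ t, p.2 t + 1 : ℕ) : ℝ) := by push_cast; ring
  rw [hc, pow_add]
  field_simp

/-- **`z(1−z) · Le'_{1::s'}(z) = Le_{s'}(z)` for `s' ≠ ∅`** (`0 < z < 1`). [folklore] -/
private theorem hasDerivAt_Le_one_cons (s' : List ℕ) (hs' : s' ≠ []) {z : ℝ} (hz : 0 < z) (hz1 : z < 1) :
    HasDerivAt (fun y => Le (1 :: s') y) (Le s' z / (z * (1 - z))) z := by
  refine (hasDerivAt_Le_one_cons_G s' hz hz1).congr_deriv ?_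
  have h1z : (1 - z) ≠ 0 := by linarith
  rw [Le_eq_tsum_pi s' hs' z, eq_div_iff (mul_ne_zero hz.ne' h1z)]
  rw [show (1 - z)⁻¹ * (∑' k' : Fin s'.length → ℕ, z ^ (∑ t, k' t) *
      mzvTerm s' (fun j => ∑ t ∈ univ.filter (fun t : Fin s'.length => (j : ℕ) ≤ (t : ℕ)), k' t + 1)) *
      (z * (1 - z)) = z * ∑' k' : Fin s'.length → ℕ, z ^ (∑ t, k' t) *
      mzvTerm s' (fun j => ∑ t ∈ univ.filter (fun t : Fin s'.length => (j : ℕ) ≤ (t : ℕ)), k' t + 1) by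
    field_simp]
  rw [← tsum_mul_left]
  refine tsum_congr fun k' => ?_
  rw [pow_succ]
  ring

/-- **`(1−z) · Le'_{1}(z) = 1`**: `Le_{(1)}(z) = −log(1−z)` has derivative `1/(1−z)` (`0 < z < 1`). [folklore] -/
private theorem hasDerivAt_Le_one {z : ℝ} (hz : 0 < z) (hz1 : z < 1) :
    HasDerivAt (fun y => Le [1] y) (1 / (1 - z)) z := by
  refine (hasDerivAt_Le_one_cons_G [] hz hz1).congr_deriv ?_
  have huniq : ∀ k' : Fin ([] : List ℕ).length → ℕ, k' = fun _ => 0 :=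
    fun k' => funext fun i => Fin.elim0 i
  rw [tsum_eq_single (fun _ => 0) (fun k' hk' => (hk' (huniq k')).elim)]
  simp only [Finset.sum_const_zero, pow_zero, one_mul, one_div]
  have h1 : ∀ n : Fin ([] : List ℕ).length → ℕ, mzvTerm [] n = 1 := by
    intro n
    unfold mzvTerm
    exact Finset.prod_eq_one fun i _ => Fin.elim0 i
  rw [h1, mul_one]



/-! ### Two lemmas on real polynomials: Wronskians and residues -/

/-- **Vanishing Wronskian**: if `P ≠ 0` and `P Q' = P' Q` then `Q = c P` for a real constant `c`
(the quotient `Q/P` has zero derivative on an interval where `P ≠ 0`). [folklore] -/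
private theorem eq_smul_of_wronskian_eq_zero (P Q : ℝ[X]) (hP : P ≠ 0)
    (h : P * derivative Q = derivative P * Q) : ∃ c : ℝ, Q = c • P := by
  classical
  -- a point where `P` does not vanish
  obtain ⟨x₀, hx₀⟩ : ∃ x₀ : ℝ, P.eval x₀ ≠ 0 := by
    by_contra hcon
    push Not at hcon
    exact hP (Polynomial.funext fun x => by rw [hcon x, eval_zero])
  -- an open interval around `x₀` where `P` does not vanish
  have hcont : ContinuousAt (fun x => P.eval x) x₀ := P.continuous.continuousAt
  have hev : ∀ᶠ x in nhds x₀, P.eval x ≠ 0 :=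
    hcont.eventually (isOpen_ne.mem_nhds (by exact hx₀))
  obtain ⟨ε, hε, hball⟩ := Metric.eventually_nhds_iff.mp hev
  set s : Set ℝ := Set.Ioo (x₀ - ε) (x₀ + ε) with hs_def
  have hsP : ∀ x ∈ s, P.eval x ≠ 0 := by
    intro x hx
    apply hball
    rw [Real.dist_eq, abs_lt]
    constructor <;> cases hx <;> linarith
  have hx₀s : x₀ ∈ s := ⟨by linarith, by linarith⟩
  -- `Q/P` has zero derivative on `s`
  have hderiv : ∀ x ∈ s, HasDerivAt (fun y => Q.eval y / P.eval y) 0 x := by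
    intro x hx
    have h1 := (Q.hasDerivAt x).div (P.hasDerivAt x) (hsP x hx)
    refine h1.congr_deriv ?_
    have hW : P.eval x * (derivative Q).eval x - (derivative P).eval x * Q.eval x = 0 := by
      have := congrArg (Polynomial.eval x) h
      simp only [eval_mul] at this
      linarith
    rw [div_eq_zero_iff]
    left
    linarith
  have hconst : ∀ x ∈ s, Q.eval x / P.eval x = Q.eval x₀ / P.eval x₀ := by
    intro x hx
    refine IsOpen.is_const_of_deriv_eq_zero (f := fun y => Q.eval y / P.eval y) isOpen_Ioo
      isPreconnected_Ioo ?_ ?_ hx hx₀s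
    · intro y hy
      exact (hderiv y hy).differentiableAt.differentiableWithinAt
    · intro y hy
      exact (hderiv y hy).deriv
  refine ⟨Q.eval x₀ / P.eval x₀, ?_⟩
  -- `Q - c P` vanishes on the infinite set `s`
  have hzero : Q - (Q.eval x₀ / P.eval x₀) • P = 0 := by
    apply Polynomial.eq_zero_of_infinite_isRoot
    apply Set.Infinite.mono (s := s)
    · intro x hx
      simp only [Set.mem_setOf_eq, IsRoot.def, eval_sub, eval_smul, smul_eq_mul]
      have hc := (div_eq_div_iff (hsP x hx) (hsP x₀ hx₀s)).mp (hconst x hx)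
      rw [sub_eq_zero, div_mul_eq_mul_div, eq_div_iff (hsP x₀ hx₀s), hc]
    · exact Set.Ioo_infinite (by linarith)
  exact (sub_eq_zero.mp hzero)

/-- `X · (X^n S)' = X^n (n S + X S')`. [folklore] -/
private theorem X_mul_derivative_X_pow_mul (n : ℕ) (S : ℝ[X]) :
    X * derivative (X ^ n * S) = X ^ n * (C (n : ℝ) * S + X * derivative S) := by
  rw [derivative_mul, derivative_X_pow]
  rcases n with _ | n
  · simp
  · rw [Nat.add_sub_cancel, pow_succ]
    push_cast
    ring

/-- **Residues at `0`**: if `P ≠ 0` and `X(1−X)(P Q' − P' Q) = (A(1−X) + BX) P²` in `ℝ[X]` — i.e.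
`(Q/P)' = A/X + B/(1−X)` — then `A = 0` (a derivative of a rational function has no residue; here by
comparing `X`-adic orders). [folklore] -/
private theorem residue_zero_left (P Q : ℝ[X]) (hP : P ≠ 0) (A B : ℝ)
    (h : X * (1 - X) * (P * derivative Q - derivative P * Q) = (C A * (1 - X) + C B * X) * P ^ 2) :
    A = 0 := by
  obtain ⟨S, hPS, hS⟩ := P.exists_eq_pow_rootMultiplicity_mul_and_not_dvd hP 0
  set e := P.rootMultiplicity 0 with he_def
  rw [map_zero, sub_zero] at hPS hS
  rw [X_dvd_iff] at hS
  by_cases hQ : Q = 0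
  · simp only [hQ, derivative_zero, mul_zero, sub_zero] at h
    have h2 : C A * (1 - X) + C B * X = 0 := by
      rcases mul_eq_zero.mp h.symm with h3 | h3
      · exact h3
      · exact absurd (pow_eq_zero_iff two_ne_zero |>.mp h3) hP
    have := congrArg (Polynomial.eval 0) h2
    simpa using this
  obtain ⟨T, hQT, hT⟩ := Q.exists_eq_pow_rootMultiplicity_mul_and_not_dvd hQ 0
  set g := Q.rootMultiplicity 0 with hg_def
  rw [map_zero, sub_zero] at hQT hT
  rw [X_dvd_iff] at hT
  -- `X (P Q' − P' Q) = X^{e+g} ((g − e) S T + X (S T' − S' T))`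
  have hW : X * (P * derivative Q - derivative P * Q) =
      X ^ (e + g) * (C ((g : ℝ) - (e : ℝ)) * S * T + X * (S * derivative T - derivative S * T)) := by
    have h1 := X_mul_derivative_X_pow_mul e S
    have h2 := X_mul_derivative_X_pow_mul g T
    rw [hPS, hQT]
    have : X * (X ^ e * S * derivative (X ^ g * T) - derivative (X ^ e * S) * (X ^ g * T))
        = X ^ e * S * (X * derivative (X ^ g * T)) - (X * derivative (X ^ e * S)) * (X ^ g * T) := by ring
    rw [this, h1, h2, pow_add, map_sub]
    ring
  -- multiply `h` by `X`
  have hX : (1 - X) * X ^ (e + g + 1) *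
      (C ((g : ℝ) - (e : ℝ)) * S * T + X * (S * derivative T - derivative S * T))
      = (C A * (1 - X) + C B * X) * X ^ (2 * e + 1) * S ^ 2 := by
    have h' : X * (X * (1 - X) * (P * derivative Q - derivative P * Q))
        = X * ((C A * (1 - X) + C B * X) * P ^ 2) := by rw [h]
    rw [show X * (X * (1 - X) * (P * derivative Q - derivative P * Q))
        = X * (1 - X) * (X * (P * derivative Q - derivative P * Q)) by ring, hW, hPS] at h'
    linear_combination h'
  have hXne : ∀ n : ℕ, (X : ℝ[X]) ^ n ≠ 0 := fun n => pow_ne_zero n X_ne_zero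
  have hS0 : eval 0 S ≠ 0 := by rwa [← coeff_zero_eq_eval_zero]
  have hT0 : eval 0 T ≠ 0 := by rwa [← coeff_zero_eq_eval_zero]
  rcases lt_trichotomy g e with hlt | heq | hgt
  · -- `g < e`: impossible
    exfalso
    obtain ⟨d, hd⟩ : ∃ d, e = g + d + 1 := ⟨e - g - 1, by omega⟩
    have h3 : X ^ (e + g + 1) * ((1 - X) *
        (C ((g : ℝ) - (e : ℝ)) * S * T + X * (S * derivative T - derivative S * T)))
        = X ^ (e + g + 1) * ((C A * (1 - X) + C B * X) * X ^ (d + 1) * S ^ 2) := by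
      have h4 : (X : ℝ[X]) ^ (2 * e + 1) = X ^ (e + g + 1) * X ^ (d + 1) := by
        rw [← pow_add]; congr 1; omega
      rw [h4] at hX
      linear_combination hX
    have h5 := mul_left_cancel₀ (hXne _) h3
    have h6 : (1 - 0 : ℝ) * (((g : ℝ) - (e : ℝ)) * eval 0 S * eval 0 T +
        0 * (eval 0 S * eval 0 (derivative T) - eval 0 (derivative S) * eval 0 T))
        = (A * (1 - 0) + B * 0) * 0 ^ (d + 1) * eval 0 S ^ 2 := by
      have := congrArg (Polynomial.eval 0) h5
      simpa only [eval_mul, eval_sub, eval_add, eval_one, eval_X, eval_C, eval_pow] using this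
    have h7 : ((g : ℝ) - (e : ℝ)) * eval 0 S * eval 0 T = 0 := by
      have h8 : (0 : ℝ) ^ (d + 1) = 0 := zero_pow (by omega)
      rw [h8] at h6
      linarith [h6]
    rcases mul_eq_zero.mp h7 with h8 | h8
    · rcases mul_eq_zero.mp h8 with h9 | h9
      · have : (g : ℝ) - (e : ℝ) ≠ 0 := by
          rw [sub_ne_zero]; exact_mod_cast hlt.ne
        exact this h9
      · exact hS0 h9
    · exact hT0 h8
  · -- `g = e`
    have h3 : X ^ (2 * e + 1) * ((1 - X) *
        (C ((g : ℝ) - (e : ℝ)) * S * T + X * (S * derivative T - derivative S * T)))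
        = X ^ (2 * e + 1) * ((C A * (1 - X) + C B * X) * S ^ 2) := by
      have h4 : (X : ℝ[X]) ^ (e + g + 1) = X ^ (2 * e + 1) := by congr 1; omega
      rw [h4] at hX
      linear_combination hX
    have h5 := mul_left_cancel₀ (hXne _) h3
    have h6 : (1 - 0 : ℝ) * (((g : ℝ) - (e : ℝ)) * eval 0 S * eval 0 T +
        0 * (eval 0 S * eval 0 (derivative T) - eval 0 (derivative S) * eval 0 T))
        = (A * (1 - 0) + B * 0) * eval 0 S ^ 2 := by
      have := congrArg (Polynomial.eval 0) h5
      simpa only [eval_mul, eval_sub, eval_add, eval_one, eval_X, eval_C, eval_pow] using this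
    have hge : (g : ℝ) - (e : ℝ) = 0 := by rw [heq]; ring
    rw [hge] at h6
    have : A * (eval 0 S) ^ 2 = 0 := by linarith [h6]
    rcases mul_eq_zero.mp this with h7 | h7
    · exact h7
    · exact absurd (pow_eq_zero_iff two_ne_zero |>.mp h7) hS0
  · -- `g > e`
    obtain ⟨d, hd⟩ : ∃ d, g = e + d + 1 := ⟨g - e - 1, by omega⟩
    have h3 : X ^ (2 * e + 1) * ((1 - X) * X ^ (d + 1) *
        (C ((g : ℝ) - (e : ℝ)) * S * T + X * (S * derivative T - derivative S * T)))
        = X ^ (2 * e + 1) * ((C A * (1 - X) + C B * X) * S ^ 2) := by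
      have h4 : (X : ℝ[X]) ^ (e + g + 1) = X ^ (2 * e + 1) * X ^ (d + 1) := by
        rw [← pow_add]; congr 1; omega
      rw [h4] at hX
      linear_combination hX
    have h5 := mul_left_cancel₀ (hXne _) h3
    have h6 : (1 - 0 : ℝ) * 0 ^ (d + 1) * (((g : ℝ) - (e : ℝ)) * eval 0 S * eval 0 T +
        0 * (eval 0 S * eval 0 (derivative T) - eval 0 (derivative S) * eval 0 T))
        = (A * (1 - 0) + B * 0) * eval 0 S ^ 2 := by
      have := congrArg (Polynomial.eval 0) h5
      simpa only [eval_mul, eval_sub, eval_add, eval_one, eval_X, eval_C, eval_pow] using this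
    have : A * (eval 0 S) ^ 2 = 0 := by
      have h8 : (0 : ℝ) ^ (d + 1) = 0 := zero_pow (by omega)
      rw [h8] at h6
      linarith [h6]
    rcases mul_eq_zero.mp this with h7 | h7
    · exact h7
    · exact absurd (pow_eq_zero_iff two_ne_zero |>.mp h7) hS0

/-- **Residues at `0` and `1`**: if `P ≠ 0` and `X(1−X)(P Q' − P' Q) = (A(1−X) + BX) P²` then
`A = B = 0` (the case `B` by the reflection `X ↦ 1 − X`). [folklore] -/
private theorem residue_zero (P Q : ℝ[X]) (hP : P ≠ 0) (A B : ℝ)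
    (h : X * (1 - X) * (P * derivative Q - derivative P * Q) = (C A * (1 - X) + C B * X) * P ^ 2) :
    A = 0 ∧ B = 0 := by
  refine ⟨residue_zero_left P Q hP A B h, ?_⟩
  -- reflect: `X ↦ 1 − X`
  have hd1 : derivative (1 - X : ℝ[X]) = -1 := by
    rw [derivative_sub, derivative_one, derivative_X, zero_sub]
  have hPq : P.comp (1 - X) ≠ 0 := by
    intro hc
    rcases comp_eq_zero_iff.mp hc with h1 | ⟨-, h2⟩
    · exact hP h1
    · have := congrArg (fun p : ℝ[X] => p.coeff 1) h2
      simp at this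
  have hdP : (derivative P).comp (1 - X) = -derivative (P.comp (1 - X)) := by
    rw [derivative_comp, hd1]; ring
  have hdQ : (derivative Q).comp (1 - X) = -derivative (Q.comp (1 - X)) := by
    rw [derivative_comp, hd1]; ring
  have h2 := congrArg (fun R => R.comp (1 - X)) h
  simp only [mul_comp, sub_comp, add_comp, X_comp, one_comp, C_comp, pow_comp] at h2
  rw [hdP, hdQ] at h2
  have h3 : X * (1 - X) *
      (P.comp (1 - X) * derivative (Q.comp (1 - X)) - derivative (P.comp (1 - X)) * Q.comp (1 - X))
      = (C (-B) * (1 - X) + C (-A) * X) * (P.comp (1 - X)) ^ 2 := by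
    simp only [map_neg]
    linear_combination -h2
  have := residue_zero_left (P.comp (1 - X)) (Q.comp (1 - X)) hPq (-B) (-A) h3
  linarith


/-! ### Positive words of bounded weight; reindexing sums over parents -/

/-- Membership in the finite set of words with positive entries and weight `≤ M` (compositions of the
integers `0, …, M`). [folklore] -/
private theorem mem_W {M : ℕ} {s : List ℕ} :
    s ∈ (Finset.range (M + 1)).biUnion
        (fun n => (Finset.univ : Finset (Composition n)).image Composition.blocks) ↔
      (∀ x ∈ s, 0 < x) ∧ s.sum ≤ M := by
  simp only [Finset.mem_biUnion, Finset.mem_range, Finset.mem_image, Finset.mem_univ, true_and]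
  constructor
  · rintro ⟨n, hn, c, rfl⟩
    exact ⟨fun x hx => c.blocks_pos hx, by rw [c.blocks_sum]; omega⟩
  · rintro ⟨hpos, hsum⟩
    exact ⟨s.sum, by omega, ⟨s, fun {i} hi => hpos i hi, rfl⟩, rfl⟩

/-- A word with positive entries and weight `0` is empty. [folklore] -/
private theorem eq_nil_of_sum_eq_zero {v : List ℕ} (hpos : ∀ x ∈ v, 0 < x) (h : v.sum = 0) : v = [] := by
  rcases v with _ | ⟨a, t⟩
  · rfl
  · exfalso
    have ha := hpos a (by simp)
    rw [List.sum_cons] at h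
    omega

/-- Reindexing a sum over the words with first letter `1` by their tails. [folklore] -/
private theorem sum_reindex_head_one (W : Finset (List ℕ)) (hW : ∀ v ∈ W, v ≠ [] → v.tail ∈ W)
    (F : List ℕ → ℝ) :
    ∑ v ∈ W.filter (fun v => v ≠ [] ∧ v.headD 0 = 1), F v
      = ∑ s ∈ W.filter (fun s => 1 :: s ∈ W), F (1 :: s) := by
  refine Finset.sum_nbij' (fun v => v.tail) (fun s => 1 :: s) ?_ ?_ ?_ ?_ ?_
  · intro v hv
    rw [Finset.mem_filter] at hv ⊢
    obtain ⟨hvW, hvne, hvh⟩ := hv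
    obtain ⟨a, t, rfl⟩ := List.exists_cons_of_ne_nil hvne
    simp only [List.headD_cons] at hvh
    subst hvh
    exact ⟨hW _ hvW hvne, by simpa using hvW⟩
  · intro s hs
    rw [Finset.mem_filter] at hs ⊢
    exact ⟨hs.2, List.cons_ne_nil _ _, by simp⟩
  · intro v hv
    rw [Finset.mem_filter] at hv
    obtain ⟨-, hvne, hvh⟩ := hv
    obtain ⟨a, t, rfl⟩ := List.exists_cons_of_ne_nil hvne
    simp only [List.headD_cons] at hvh
    subst hvh
    rfl
  · intro s _
    rfl
  · intro v hv
    rw [Finset.mem_filter] at hv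
    obtain ⟨-, hvne, hvh⟩ := hv
    obtain ⟨a, t, rfl⟩ := List.exists_cons_of_ne_nil hvne
    simp only [List.headD_cons] at hvh
    subst hvh
    rfl

/-- Reindexing a sum over the words with first letter `≥ 2` by lowering the first letter. [folklore] -/
private theorem sum_reindex_head_two (W : Finset (List ℕ)) (hWpos : ∀ v ∈ W, ∀ x ∈ v, 0 < x)
    (hW : ∀ v ∈ W, v ≠ [] → 2 ≤ v.headD 0 → (v.headD 0 - 1) :: v.tail ∈ W) (F : List ℕ → ℝ) :
    ∑ v ∈ W.filter (fun v => v ≠ [] ∧ 2 ≤ v.headD 0), F v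
      = ∑ s ∈ W.filter (fun s => s ≠ [] ∧ (s.headD 0 + 1) :: s.tail ∈ W), F ((s.headD 0 + 1) :: s.tail) := by
  refine Finset.sum_nbij' (fun v => (v.headD 0 - 1) :: v.tail) (fun s => (s.headD 0 + 1) :: s.tail)
    ?_ ?_ ?_ ?_ ?_
  · intro v hv
    rw [Finset.mem_filter] at hv ⊢
    obtain ⟨hvW, hvne, hvh⟩ := hv
    refine ⟨hW v hvW hvne hvh, List.cons_ne_nil _ _, ?_⟩
    obtain ⟨a, t, rfl⟩ := List.exists_cons_of_ne_nil hvne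
    simp only [List.headD_cons] at hvh
    simp only [List.headD_cons, List.tail_cons, Nat.sub_add_cancel (le_of_lt hvh)]
    exact hvW
  · intro s hs
    rw [Finset.mem_filter] at hs ⊢
    obtain ⟨hsW, hsne, hsp⟩ := hs
    refine ⟨hsp, List.cons_ne_nil _ _, ?_⟩
    obtain ⟨a, t, rfl⟩ := List.exists_cons_of_ne_nil hsne
    have ha := hWpos _ hsW a (by simp)
    simp only [List.headD_cons]
    omega
  · intro v hv
    rw [Finset.mem_filter] at hv
    obtain ⟨-, hvne, hvh⟩ := hv
    obtain ⟨a, t, rfl⟩ := List.exists_cons_of_ne_nil hvne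
    simp only [List.headD_cons] at hvh
    simp only [List.headD_cons, List.tail_cons, Nat.sub_add_cancel (le_of_lt hvh)]
  · intro s hs
    rw [Finset.mem_filter] at hs
    obtain ⟨-, hsne, -⟩ := hs
    obtain ⟨a, t, rfl⟩ := List.exists_cons_of_ne_nil hsne
    simp
  · intro v hv
    rw [Finset.mem_filter] at hv
    obtain ⟨-, hvne, hvh⟩ := hv
    obtain ⟨a, t, rfl⟩ := List.exists_cons_of_ne_nil hvne
    simp only [List.headD_cons] at hvh
    simp only [List.headD_cons, List.tail_cons, Nat.sub_add_cancel (le_of_lt hvh)]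

/-- The derivative of `Le_{a :: w}` (`a ≥ 1`) at `0 < z < 1` in closed form:
`z(1−z) Le'_{a::w}(z) = (1−z) Le_{(a−1)::w}(z)` if `a ≥ 2`, `= Le_w(z)` if `a = 1 ≠ w = ∅`… i.e. `= Le_w(z)`
for `a = 1`, `w ≠ ∅`, and `= z` for `a :: w = (1)`. [folklore] -/
private theorem hasDerivAt_Le_pos (a : ℕ) (w : List ℕ) (ha : 0 < a) {z : ℝ} (hz : 0 < z) (hz1 : z < 1) :
    HasDerivAt (fun y => Le (a :: w) y)
      ((if a = 1 then (if w = [] then z else 1) * Le w z else (1 - z) * Le ((a - 1) :: w) z) /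
        (z * (1 - z))) z := by
  have h1z : (1 - z) ≠ 0 := by linarith
  by_cases ha1 : a = 1
  · subst ha1
    by_cases hw : w = []
    · subst hw
      refine (hasDerivAt_Le_one hz hz1).congr_deriv ?_
      rw [if_pos rfl, if_pos rfl, Le_nil]
      field_simp
    · refine (hasDerivAt_Le_one_cons w hw hz hz1).congr_deriv ?_
      rw [if_pos rfl, if_neg hw, one_mul]
  · obtain ⟨b, rfl⟩ : ∃ b, a = b + 2 := ⟨a - 2, by omega⟩
    refine (hasDerivAt_Le_cons_of_two_le b w hz hz1).congr_deriv ?_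
    rw [if_neg ha1, show b + 2 - 1 = b + 1 by omega]
    field_simp

/-! ### The descent -/

/-- **The relation obtained by differentiating and eliminating one top coefficient.** If the
coefficients `P_v` (supported on positive words of weight `≤ M`) satisfy `Σ_v P_v(z) Le_v(z) = 0` on
`(0,1)`, then for every polynomial `Q` the coefficients
`R_s = X(1−X)(Q P_s' − Q' P_s) + Q·((1−X) P_{(s₁+1, s₂, …)} + ψ_s P_{(1, s₁, …)})` (`ψ_∅ = X`, `ψ_s = 1`
otherwise; the first parent only for `s ≠ ∅`) satisfy the same kind of relation — this is
`z(1−z)·(Q·(Σ_v P_v Le_v)' − Q'·Σ_v P_v Le_v) = 0` regrouped by `z(1−z) Le'_v = φ_v Le_{∂v}`. [folklore] -/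
private theorem descent_relation (M : ℕ) (P : List ℕ → ℝ[X]) (Q : ℝ[X])
    (hP : ∀ v, P v ≠ 0 → (∀ x ∈ v, 0 < x) ∧ v.sum ≤ M)
    (hrel : ∀ z : ℝ, 0 < z → z < 1 →
      ∑ v ∈ (Finset.range (M + 1)).biUnion
        (fun n => (Finset.univ : Finset (Composition n)).image Composition.blocks),
        (P v).eval z * Le v z = 0)
    {z : ℝ} (hz : 0 < z) (hz1 : z < 1) :
    ∑ s ∈ (Finset.range (M + 1)).biUnion
        (fun n => (Finset.univ : Finset (Composition n)).image Composition.blocks),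
      (X * (1 - X) * (Q * derivative (P s) - derivative Q * P s) +
        Q * ((if s = [] then 0 else (1 - X) * P ((s.headD 0 + 1) :: s.tail)) +
          (if s = [] then X else 1) * P (1 :: s))).eval z * Le s z = 0 := by
  set W := (Finset.range (M + 1)).biUnion
        (fun n => (Finset.univ : Finset (Composition n)).image Composition.blocks) with hW_def
  have hWpos : ∀ v ∈ W, ∀ x ∈ v, 0 < x := fun v hv => (mem_W.mp hv).1
  have hWtail : ∀ v ∈ W, v ≠ [] → v.tail ∈ W := by
    intro v hv hvne
    obtain ⟨hpos, hsum⟩ := mem_W.mp hv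
    obtain ⟨a, t, rfl⟩ := List.exists_cons_of_ne_nil hvne
    rw [List.sum_cons] at hsum
    exact mem_W.mpr ⟨fun x hx => hpos x (List.mem_cons_of_mem a hx), by simp; omega⟩
  have hWpred : ∀ v ∈ W, v ≠ [] → 2 ≤ v.headD 0 → (v.headD 0 - 1) :: v.tail ∈ W := by
    intro v hv hvne hvh
    obtain ⟨hpos, hsum⟩ := mem_W.mp hv
    obtain ⟨a, t, rfl⟩ := List.exists_cons_of_ne_nil hvne
    simp only [List.headD_cons] at hvh
    rw [List.sum_cons] at hsum
    refine mem_W.mpr ⟨?_, ?_⟩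
    · intro x hx
      simp only [List.headD_cons, List.tail_cons, List.mem_cons] at hx
      rcases hx with rfl | hx
      · omega
      · exact hpos x (List.mem_cons_of_mem a hx)
    · simp only [List.headD_cons, List.tail_cons, List.sum_cons]
      omega
  have hPW : ∀ v, v ∉ W → P v = 0 := by
    intro v hv
    by_contra h
    exact hv (mem_W.mpr (hP v h))
  have h1z : (1 - z) ≠ 0 := by linarith
  have hzz : z * (1 - z) ≠ 0 := mul_ne_zero hz.ne' h1z
  -- the derivative of `Le_v`, `v ∈ W`, in closed form `N v / (z(1−z))`
  have hLe : ∀ v ∈ W, HasDerivAt (fun y => Le v y)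
      ((if v = [] then 0 else (if v.headD 0 = 1 then (if v.tail = [] then z else 1) * Le v.tail z
        else (1 - z) * Le ((v.headD 0 - 1) :: v.tail) z)) / (z * (1 - z))) z := by
    intro v hv
    by_cases hv0 : v = []
    · subst hv0
      rw [if_pos rfl, zero_div]
      simp only [Le_nil]
      exact hasDerivAt_const z 1
    · obtain ⟨a, t, rfl⟩ := List.exists_cons_of_ne_nil hv0
      have ha := hWpos _ hv a (by simp)
      have h := hasDerivAt_Le_pos a t ha hz hz1
      rw [if_neg hv0]
      simp only [List.headD_cons, List.tail_cons]
      convert h using 4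
      exact if_congr Iff.rfl rfl rfl
  -- the relation, differentiated
  have hD : HasDerivAt (fun y => ∑ v ∈ W, (P v).eval y * Le v y)
      (∑ v ∈ W, ((derivative (P v)).eval z * Le v z + (P v).eval z *
        ((if v = [] then 0 else (if v.headD 0 = 1 then (if v.tail = [] then z else 1) * Le v.tail z
          else (1 - z) * Le ((v.headD 0 - 1) :: v.tail) z)) / (z * (1 - z))))) z :=
    HasDerivAt.fun_sum fun v hv => ((P v).hasDerivAt z).mul (hLe v hv)
  have hD0 : ∑ v ∈ W, ((derivative (P v)).eval z * Le v z + (P v).eval z *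
        ((if v = [] then 0 else (if v.headD 0 = 1 then (if v.tail = [] then z else 1) * Le v.tail z
          else (1 - z) * Le ((v.headD 0 - 1) :: v.tail) z)) / (z * (1 - z)))) = 0 := by
    have h1 : HasDerivAt (fun y => ∑ v ∈ W, (P v).eval y * Le v y) 0 z := by
      refine (hasDerivAt_const z (0 : ℝ)).congr_of_eventuallyEq ?_
      filter_upwards [Ioo_mem_nhds hz hz1] with y hy using hrel y hy.1 hy.2
    exact hD.unique h1
  -- regrouping the parents: `Σ_s T_s(z) Le_s(z) = Σ_v P_v(z) N_v(z)`
  have hKI : ∑ s ∈ W, ((if s = [] then (0 : ℝ) else (1 - z) * (P ((s.headD 0 + 1) :: s.tail)).eval z)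
        + (if s = [] then z else 1) * (P (1 :: s)).eval z) * Le s z
      = ∑ v ∈ W, (P v).eval z *
        (if v = [] then 0 else (if v.headD 0 = 1 then (if v.tail = [] then z else 1) * Le v.tail z
          else (1 - z) * Le ((v.headD 0 - 1) :: v.tail) z)) := by
    have hsplit : ∀ v ∈ W, (P v).eval z *
        (if v = [] then 0 else (if v.headD 0 = 1 then (if v.tail = [] then z else 1) * Le v.tail z
          else (1 - z) * Le ((v.headD 0 - 1) :: v.tail) z))
        = (if (v ≠ [] ∧ v.headD 0 = 1) then
            (P v).eval z * ((if v.tail = [] then z else 1) * Le v.tail z) else 0)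
          + (if (v ≠ [] ∧ 2 ≤ v.headD 0) then
            (P v).eval z * ((1 - z) * Le ((v.headD 0 - 1) :: v.tail) z) else 0) := by
      intro v hv
      by_cases hv0 : v = []
      · simp [hv0]
      · obtain ⟨a, t, rfl⟩ := List.exists_cons_of_ne_nil hv0
        have ha := hWpos _ hv a (by simp)
        by_cases ha1 : a = 1
        · subst ha1
          simp
        · have ha2 : 2 ≤ a := by omega
          simp [ha1, ha2]
    rw [Finset.sum_congr rfl hsplit, Finset.sum_add_distrib, ← Finset.sum_filter, ← Finset.sum_filter,
      sum_reindex_head_one W hWtail, sum_reindex_head_two W hWpos hWpred, Finset.sum_filter,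
      Finset.sum_filter]
    simp only [List.headD_cons, List.tail_cons, add_mul, Finset.sum_add_distrib]
    rw [add_comm]
    congr 1
    · refine Finset.sum_congr rfl fun s hs => ?_
      by_cases hmem : 1 :: s ∈ W
      · rw [if_pos hmem]; ring
      · rw [if_neg hmem, hPW _ hmem, eval_zero]; ring
    · refine Finset.sum_congr rfl fun s hs => ?_
      by_cases hs0 : s = []
      · subst hs0
        simp
      · by_cases hmem : (s.headD 0 + 1) :: s.tail ∈ W
        · rw [if_pos (show s ≠ [] ∧ (s.headD 0 + 1) :: s.tail ∈ W from ⟨hs0, hmem⟩), if_neg hs0]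
          obtain ⟨a, t, rfl⟩ := List.exists_cons_of_ne_nil hs0
          simp only [List.headD_cons, List.tail_cons, Nat.add_sub_cancel]
          ring
        · rw [if_neg (show ¬ (s ≠ [] ∧ (s.headD 0 + 1) :: s.tail ∈ W) from fun h => hmem h.2),
            if_neg hs0, hPW _ hmem, eval_zero]
          ring
  -- assembling
  have hterm : ∀ s ∈ W, (X * (1 - X) * (Q * derivative (P s) - derivative Q * P s) +
        Q * ((if s = [] then 0 else (1 - X) * P ((s.headD 0 + 1) :: s.tail)) +
          (if s = [] then X else 1) * P (1 :: s))).eval z * Le s z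
      = z * (1 - z) * Q.eval z * ((derivative (P s)).eval z * Le s z + (P s).eval z *
          ((if s = [] then 0 else (if s.headD 0 = 1 then (if s.tail = [] then z else 1) * Le s.tail z
            else (1 - z) * Le ((s.headD 0 - 1) :: s.tail) z)) / (z * (1 - z))))
        - z * (1 - z) * (derivative Q).eval z * ((P s).eval z * Le s z)
        + Q.eval z * (((if s = [] then (0 : ℝ) else (1 - z) * (P ((s.headD 0 + 1) :: s.tail)).eval z)
            + (if s = [] then z else 1) * (P (1 :: s)).eval z) * Le s z
          - (P s).eval z * (if s = [] then 0 else (if s.headD 0 = 1 then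
              (if s.tail = [] then z else 1) * Le s.tail z
            else (1 - z) * Le ((s.headD 0 - 1) :: s.tail) z))) := by
    intro s hs
    by_cases hs0 : s = []
    · subst hs0
      simp only [↓reduceIte, eval_add, eval_mul, eval_sub, eval_X, eval_one, zero_div,
        mul_zero, zero_add, sub_zero]
      ring
    · simp only [if_neg hs0, eval_add, eval_mul, eval_sub, eval_X, eval_one, one_mul]
      field_simp
      ring
  rw [Finset.sum_congr rfl hterm, Finset.sum_add_distrib, Finset.sum_sub_distrib, ← Finset.mul_sum,
    ← Finset.mul_sum, ← Finset.mul_sum, hD0, hrel z hz hz1, Finset.sum_sub_distrib, hKI, sub_self]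
  ring

/-- **The descent** (induction on the weight `M`, then on the number of nonzero coefficients of top
weight): a relation `Σ_v P_v(z) Le_v(z) = 0` on `(0,1)` with real polynomial coefficients supported on
positive words of weight `≤ M` is trivial. Step: pick a top word `w₀` with `P_{w₀} ≠ 0`; the relation of
`descent_relation` with `Q = P_{w₀}` has fewer nonzero top coefficients, hence vanishes; its top
coefficients give `P_s ∝ P_{w₀}` (vanishing Wronskians), and its coefficient at `∂w₀` gives
`(P_{∂w₀}/P_{w₀})' = α/X + β/(1−X)` with `(α, β) ≠ (0, 0)` — impossible by `residue_zero`. [folklore] -/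
private theorem descent : ∀ (M k : ℕ) (P : List ℕ → ℝ[X]),
    (∀ v, P v ≠ 0 → (∀ x ∈ v, 0 < x) ∧ v.sum ≤ M) →
    (((Finset.range (M + 1)).biUnion
        (fun n => (Finset.univ : Finset (Composition n)).image Composition.blocks)).filter
        (fun v => v.sum = M ∧ P v ≠ 0)).card ≤ k →
    (∀ z : ℝ, 0 < z → z < 1 →
      ∑ v ∈ (Finset.range (M + 1)).biUnion
        (fun n => (Finset.univ : Finset (Composition n)).image Composition.blocks),
        (P v).eval z * Le v z = 0) →
    ∀ v, P v = 0 := by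
  intro M
  induction M with
  | zero =>
    intro k P hP _ hrel v
    have hnil : ∀ w, P w ≠ 0 → w = [] := fun w hw =>
      eq_nil_of_sum_eq_zero (hP w hw).1 (Nat.le_zero.mp (hP w hw).2)
    by_cases hv : v = []
    · subst hv
      have h0 : ∀ z : ℝ, 0 < z → z < 1 → (P []).eval z = 0 := by
        intro z hz hz1
        have h := hrel z hz hz1
        rw [Finset.sum_eq_single_of_mem ([] : List ℕ) (mem_W.mpr ⟨by simp, by simp⟩), Le_nil,
          mul_one] at h
        · exact h
        · intro w _ hwne
          have : P w = 0 := by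
            by_contra hPw
            exact hwne (hnil w hPw)
          rw [this, eval_zero, zero_mul]
      apply Polynomial.eq_zero_of_infinite_isRoot
      exact Set.Infinite.mono (fun z hz => h0 z hz.1 hz.2) (Set.Ioo_infinite zero_lt_one)
    · by_contra hPv
      exact hv (hnil v hPv)
  | succ m ih =>
    intro k
    induction k with
    | zero =>
      intro P hP hcard hrel
      have hP' : ∀ v, P v ≠ 0 → (∀ x ∈ v, 0 < x) ∧ v.sum ≤ m := by
        intro v hv
        obtain ⟨hpos, hsum⟩ := hP v hv
        refine ⟨hpos, ?_⟩
        by_contra hgt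
        have hmem : v ∈ ((Finset.range (m + 1 + 1)).biUnion
            (fun n => (Finset.univ : Finset (Composition n)).image Composition.blocks)).filter
            (fun v => v.sum = m + 1 ∧ P v ≠ 0) :=
          Finset.mem_filter.mpr ⟨mem_W.mpr ⟨hpos, hsum⟩, by omega, hv⟩
        rw [Finset.card_eq_zero.mp (Nat.le_zero.mp hcard)] at hmem
        exact Finset.notMem_empty _ hmem
      refine ih _ P hP' le_rfl ?_
      intro z hz hz1
      rw [← hrel z hz hz1]
      apply Finset.sum_subset
      · intro v hv
        obtain ⟨hpos, hsum⟩ := mem_W.mp hv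
        exact mem_W.mpr ⟨hpos, by omega⟩
      · intro v _ hv
        have : P v = 0 := by
          by_contra hPv
          exact hv (mem_W.mpr (hP' v hPv))
        rw [this, eval_zero, zero_mul]
    | succ k ihk =>
      intro P hP hcard hrel
      by_cases hc : (((Finset.range (m + 1 + 1)).biUnion
          (fun n => (Finset.univ : Finset (Composition n)).image Composition.blocks)).filter
          (fun v => v.sum = m + 1 ∧ P v ≠ 0)).card ≤ k
      · exact ihk P hP hc hrel
      · exfalso
        set W := (Finset.range (m + 1 + 1)).biUnion
          (fun n => (Finset.univ : Finset (Composition n)).image Composition.blocks) with hW_def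
        obtain ⟨w0, hw0⟩ := Finset.card_pos.mp
          (show 0 < (W.filter (fun v => v.sum = m + 1 ∧ P v ≠ 0)).card by omega)
        obtain ⟨hw0W, hw0sum, hPw0⟩ := Finset.mem_filter.mp hw0
        have hw0pos : ∀ x ∈ w0, 0 < x := (mem_W.mp hw0W).1
        -- the new relation
        set R : List ℕ → ℝ[X] := fun s => if (∀ x ∈ s, 0 < x) then
            X * (1 - X) * (P w0 * derivative (P s) - derivative (P w0) * P s) +
              P w0 * ((if s = [] then 0 else (1 - X) * P ((s.headD 0 + 1) :: s.tail)) +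
                (if s = [] then X else 1) * P (1 :: s)) else 0 with hR_def
        -- support of `R`
        have hparent1 : ∀ s : List ℕ, m + 1 ≤ s.sum → P (1 :: s) = 0 := by
          intro s hs
          by_contra h
          have := (hP _ h).2
          rw [List.sum_cons] at this
          omega
        have hparent2 : ∀ s : List ℕ, s ≠ [] → m + 1 ≤ s.sum → P ((s.headD 0 + 1) :: s.tail) = 0 := by
          intro s hsne hs
          by_contra h
          have := (hP _ h).2
          obtain ⟨a, t, rfl⟩ := List.exists_cons_of_ne_nil hsne
          simp only [List.headD_cons, List.tail_cons, List.sum_cons] at this hs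
          omega
        have hR_hyp : ∀ s, R s ≠ 0 → (∀ x ∈ s, 0 < x) ∧ s.sum ≤ m + 1 := by
          intro s hs
          by_cases hpos : ∀ x ∈ s, 0 < x
          · refine ⟨hpos, ?_⟩
            by_contra hgt
            apply hs
            have h1 : P s = 0 := by
              by_contra h
              exact hgt (hP s h).2
            have h2 : P (1 :: s) = 0 := hparent1 s (by omega)
            simp only [hR_def, if_pos hpos, h1, h2, derivative_zero, mul_zero, sub_zero]
            by_cases hs0 : s = []
            · simp [hs0]
            · rw [hparent2 s hs0 (by omega)]
              simp [hs0]
          · exact absurd (by simp only [hR_def, if_neg hpos]) hs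
        have hR_top : ∀ s, (∀ x ∈ s, 0 < x) → s.sum = m + 1 →
            R s = X * (1 - X) * (P w0 * derivative (P s) - derivative (P w0) * P s) := by
          intro s hpos hsum
          simp only [hR_def, if_pos hpos, hparent1 s hsum.ge]
          by_cases hs0 : s = []
          · simp [hs0]
          · rw [hparent2 s hs0 hsum.ge]
            simp [hs0]
        have hR_card : (W.filter (fun v => v.sum = m + 1 ∧ R v ≠ 0)).card ≤ k := by
          have hsub : W.filter (fun v => v.sum = m + 1 ∧ R v ≠ 0)
              ⊆ (W.filter (fun v => v.sum = m + 1 ∧ P v ≠ 0)).erase w0 := by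
            intro v hv
            rw [Finset.mem_filter] at hv
            obtain ⟨hvW, hvsum, hRv⟩ := hv
            rw [hR_top v (mem_W.mp hvW).1 hvsum] at hRv
            rw [Finset.mem_erase, Finset.mem_filter]
            refine ⟨?_, hvW, hvsum, ?_⟩
            · rintro rfl
              apply hRv
              ring
            · intro h
              apply hRv
              rw [h, derivative_zero, mul_zero, mul_zero, sub_zero, mul_zero]
          have h1 := Finset.card_le_card hsub
          rw [Finset.card_erase_of_mem hw0] at h1
          omega
        have hR_rel : ∀ z : ℝ, 0 < z → z < 1 → ∑ v ∈ W, (R v).eval z * Le v z = 0 := by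
          intro z hz hz1
          rw [← descent_relation (m + 1) P (P w0) hP hrel hz hz1]
          refine Finset.sum_congr rfl fun s hs => ?_
          rw [show R s = _ from if_pos (mem_W.mp hs).1]
        have hR0 : ∀ v, R v = 0 := ihk R hR_hyp hR_card hR_rel
        -- top coefficients are proportional to `P w0`
        have htop : ∀ s, (∀ x ∈ s, 0 < x) → s.sum = m + 1 → ∃ c : ℝ, P s = c • P w0 := by
          intro s hpos hsum
          have h := hR0 s
          rw [hR_top s hpos hsum] at h
          have hWr : P w0 * derivative (P s) - derivative (P w0) * P s = 0 := by
            rcases mul_eq_zero.mp h with h1 | h1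
            · exfalso
              rcases mul_eq_zero.mp h1 with h2 | h2
              · exact X_ne_zero h2
              · have := congrArg (fun p : ℝ[X] => p.coeff 0) h2
                simp at this
            · exact h1
          exact eq_smul_of_wronskian_eq_zero (P w0) (P s) hPw0 (sub_eq_zero.mp hWr)
        -- the word `∂w₀` and the contradiction
        have hw0ne : w0 ≠ [] := by
          rintro rfl
          simp at hw0sum
        obtain ⟨a, t, rfl⟩ := List.exists_cons_of_ne_nil hw0ne
        have ha : 0 < a := hw0pos a (by simp)
        have htpos : ∀ x ∈ t, 0 < x := fun x hx => hw0pos x (List.mem_cons_of_mem a hx)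
        rw [List.sum_cons] at hw0sum
        by_cases ha1 : a = 1
        · subst ha1
          have hRt := hR0 t
          simp only [hR_def, if_pos htpos] at hRt
          by_cases ht : t = []
          · subst ht
            simp only [if_true] at hRt
            have hres := residue_zero (P [1]) (P []) hPw0 0 (-1) (by
              simp only [map_zero, map_neg, map_one]
              linear_combination hRt)
            linarith [hres.2]
          · obtain ⟨c1, hc1⟩ : ∃ c1 : ℝ, P ((t.headD 0 + 1) :: t.tail) = c1 • P (1 :: t) := by
              obtain ⟨b, t', rfl⟩ := List.exists_cons_of_ne_nil ht
              refine htop _ ?_ ?_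
              · intro x hx
                simp only [List.headD_cons, List.tail_cons, List.mem_cons] at hx
                rcases hx with rfl | hx
                · omega
                · exact htpos x (List.mem_cons_of_mem b hx)
              · simp only [List.headD_cons, List.tail_cons, List.sum_cons] at hw0sum ⊢
                omega
            rw [if_neg ht, if_neg ht, hc1] at hRt
            have hres := residue_zero (P (1 :: t)) (P t) hPw0 (-c1 - 1) (-1) (by
              simp only [map_sub, map_neg, map_one, smul_eq_C_mul] at hRt ⊢
              linear_combination hRt)
            linarith [hres.2]
        · have ha2 : 2 ≤ a := by omega
          have hupos : ∀ x ∈ (a - 1) :: t, 0 < x := by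
            intro x hx
            rcases List.mem_cons.mp hx with rfl | hx
            · omega
            · exact htpos x hx
          have hRu := hR0 ((a - 1) :: t)
          simp only [hR_def, if_pos hupos, List.headD_cons, List.tail_cons, Nat.sub_add_cancel (show 1 ≤ a by omega),
            reduceCtorEq, if_false] at hRu
          obtain ⟨c2, hc2⟩ : ∃ c2 : ℝ, P (1 :: (a - 1) :: t) = c2 • P (a :: t) := by
            refine htop _ ?_ ?_
            · intro x hx
              rcases List.mem_cons.mp hx with rfl | hx
              · omega
              · exact hupos x hx
            · simp only [List.sum_cons]
              omega
          rw [hc2] at hRu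
          have hres := residue_zero (P (a :: t)) (P ((a - 1) :: t)) hPw0 (-1 - c2) (-c2) (by
            simp only [map_sub, map_neg, map_one, smul_eq_C_mul] at hRu ⊢
            linear_combination hRu)
          linarith [hres.1, hres.2]

/-- **Linear independence of the generalized polylogarithms over `ℝ[z]`**: if finitely many real
polynomials `P_v`, indexed by words `v` with positive entries (the empty word included, `Le_∅ = 1`),
satisfy `Σ_v P_v(z)·Le_v(z) = 0` for all real `0 < z < 1`, then every `P_v` vanishes.
[cite: Zlobin2005Coefficients, §1 (sentence after eq. (1): "the linear independence of `Le_{s⃗}(z)` with different indices over `ℂ(z)` (see [zl5])")] [cite: Zlobin2005Expansion, §1 (as reported in Zlobin2005Coefficients)] -/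
theorem Le_linearIndependent_polynomial (V : Finset (List ℕ)) (P : List ℕ → ℝ[X])
    (hV : ∀ v ∈ V, ∀ x ∈ v, 0 < x)
    (hrel : ∀ z : ℝ, 0 < z → z < 1 → ∑ v ∈ V, (P v).eval z * Le v z = 0) :
    ∀ v ∈ V, P v = 0 := by
  classical
  -- restrict `P` to `V` and embed into the words of weight `≤ M`
  set M := V.sup List.sum with hM
  set P' : List ℕ → ℝ[X] := fun v => if v ∈ V then P v else 0 with hP'
  have hP'hyp : ∀ v, P' v ≠ 0 → (∀ x ∈ v, 0 < x) ∧ v.sum ≤ M := by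
    intro v hv
    by_cases hvV : v ∈ V
    · exact ⟨hV v hvV, Finset.le_sup (f := List.sum) hvV⟩
    · exact absurd (by simp only [hP', if_neg hvV]) hv
  have hsub : V ⊆ (Finset.range (M + 1)).biUnion
      (fun n => (Finset.univ : Finset (Composition n)).image Composition.blocks) := by
    intro v hv
    exact mem_W.mpr ⟨hV v hv, Finset.le_sup (f := List.sum) hv⟩
  have hrel' : ∀ z : ℝ, 0 < z → z < 1 →
      ∑ v ∈ (Finset.range (M + 1)).biUnion
        (fun n => (Finset.univ : Finset (Composition n)).image Composition.blocks),
        (P' v).eval z * Le v z = 0 := by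
    intro z hz hz1
    rw [← hrel z hz hz1, ← Finset.sum_subset hsub]
    · refine Finset.sum_congr rfl fun v hv => ?_
      simp only [hP', if_pos hv]
    · intro v _ hv
      simp only [hP', if_neg hv, eval_zero, zero_mul]
  have h := descent M _ P' hP'hyp le_rfl hrel'
  intro v hv
  have := h v
  simp only [hP', if_pos hv] at this
  exact this

end ExpansionUnique

open ExpansionUnique in
/-- **Uniqueness of the expansion (1)** — DISCHARGE of the named fact `expansion_unique`: an expansion
`Σ_{s⃗} P_{s⃗}(z⁻¹) Le_{s⃗}(z)` (finitely many `P_{s⃗} ∈ ℚ[X]`, indices of positive integers) of the zero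
function on `(0,1)` has all `P_{s⃗} = 0`. Proof: clear the negative powers (`z^D P(z⁻¹)` is the reflected
polynomial) and apply the linear independence of the `Le_{s⃗}` over `ℝ[z]`
(`ExpansionUnique.Le_linearIndependent_polynomial`, the classical differentiation descent).
[cite: Zlobin2005Coefficients, §1 (sentence after eq. (1))] [cite: Zlobin2005Expansion, §1 (linear independence of the `Le_{s⃗}` over `ℂ(z)`, as reported in Zlobin2005Coefficients)] -/
theorem expansion_unique_holds : expansion_unique := by
  classical
  intro coef hpos hzero
  -- common degree bound and reflected real polynomials
  set D := coef.support.sup (fun s => (coef s).natDegree) with hD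
  set P : List ℕ → ℝ[X] := fun s => ((coef s).reflect D).map (algebraMap ℚ ℝ) with hP
  have hdeg : ∀ s, (coef s).natDegree ≤ D := by
    intro s
    by_cases hs : s ∈ coef.support
    · exact Finset.le_sup (f := fun s => (coef s).natDegree) hs
    · rw [Finsupp.notMem_support_iff.mp hs, natDegree_zero]
      exact Nat.zero_le _
  -- `P_s(z) = z^D · coef_s(z⁻¹)` for `z ≠ 0`
  have heval : ∀ s, ∀ z : ℝ, z ≠ 0 → (P s).eval z = (Polynomial.aeval z⁻¹ (coef s) : ℝ) * z ^ D := by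
    intro s z hz
    haveI : Invertible (z⁻¹) := invertibleOfNonzero (inv_ne_zero hz)
    have h := eval₂_reflect_mul_pow (algebraMap ℚ ℝ) z⁻¹ D (coef s) (hdeg s)
    rw [invOf_eq_inv, inv_inv] at h
    rw [hP, eval_map, Polynomial.aeval_def, ← h, mul_assoc, ← mul_pow, inv_mul_cancel₀ hz, one_pow,
      mul_one]
  have hrel : ∀ z : ℝ, 0 < z → z < 1 → ∑ v ∈ coef.support, (P v).eval z * Le v z = 0 := by
    intro z hz hz1
    have h0 := hzero hz hz1
    unfold expansionSum Finsupp.sum at h0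
    calc ∑ v ∈ coef.support, (P v).eval z * Le v z
        = z ^ D * ∑ v ∈ coef.support, (Polynomial.aeval z⁻¹ (coef v) : ℝ) * Le v z := by
          rw [Finset.mul_sum]
          refine Finset.sum_congr rfl fun v _ => ?_
          rw [heval v z hz.ne']
          ring
      _ = 0 := by rw [h0, mul_zero]
  have h := Le_linearIndependent_polynomial coef.support P
    (fun v hv x hx => hpos v hv x hx) hrel
  ext s : 1
  by_cases hs : s ∈ coef.support
  · have h1 := h s hs
    rw [hP, Polynomial.map_eq_zero_iff (algebraMap ℚ ℝ).injective, reflect_eq_zero_iff] at h1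
    rw [h1]
    rfl
  · rw [Finsupp.notMem_support_iff.mp hs]
    rfl

end Literature.NumberTheory.Irrationality.Zlobin2005
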